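import Summits.Schanuel.Schanuel.Theorems.DiophantineDichotomyKhovanskiiApproxTypeEvLWTwo
import Literature.NumberTheory.Transcendental.LindemannWeierstrassMeasureHolds

/-!
# Route `DiophantineDichotomy`, crux `KhovanskiiApproxTypeEv`, line `anchored-reduction`:
# stub `stub_evLW_two` — the `n = 2` Lindemann–Weierstrass layer of the crux, UNCONDITIONAL

Crux `Summit.Schanuel.Schanuel.Theses.DiophantineDichotomy.KhovanskiiApproxTypeEv`
(item stmt-Schanuel-14972), line `anchored-reduction` (skeleton `Cruxes/KhovanskiiApproxTypeEv/
Lines/Sketch.lean`, v3, lead `prover-line-stmt-Schanuel-14972-c1-0`), registered stub `stub_evLW_two`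
(`--supports`).

The skeleton's former stub `stub_lwMeasure` was the named fact `Literature.NumberTheory.Transcendental.
Ably1994_lindemannWeierstrass_measure` (M. Ably, Acta Arith. 67 (1994), Théorème p. 30); the lead's
session DISCHARGED it in the Literature tree —
`Literature.NumberTheory.Transcendental.Ably1994_lindemannWeierstrass_measure_holds`
(`LindemannWeierstrassMeasureHolds.lean`; Ably §I criterion `QuantCIA.exists_const_affine_measure`,
§II Proposition principale `LWMeasure.Setup.mainProp`, §III `LWMeasure.ably1994_of_criterion_of_mainProp`,
files `LWMeasure*.lean`) — so the landed bridge `stub_evLW_two_of_ably` (p111331) now yields the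
`n = 2` Lindemann–Weierstrass layer of the crux with no hypothesis: at every `s ∈ ℚ̄²` with
`ℚ`-linearly independent coordinates the conclusion of the route's load-bearing crux holds
(`a < 1 = 1/(n−1)`, eventual in the height), kernel-checked from first principles.  The two other
stubs of the skeleton (`stub_evNonLW_two`, `stub_evRankThreeUp`) are open problems, untouched here.

## Contents
* `stub_evLW_two` — the registered stub, by name.
-/

noncomputable section

-- `Summit.Schanuel.Schanuel.…` is the mandated summit/sub-problem namespace (single-conjunct summit), hence:
set_option linter.dupNamespace false

namespace Summit.Schanuel.Schanuel.Cruxes.KhovanskiiApproxTypeEv.AnchoredReduction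

open Literature.NumberTheory.Transcendental (Ably1994_lindemannWeierstrass_measure_holds)

/-- **Registered stub `stub_evLW_two` of line `anchored-reduction` — the `n = 2` Lindemann–Weierstrass
layer of `KhovanskiiApproxTypeEv`, UNCONDITIONAL**: every `s ∈ ℚ̄²` with `ℚ`-linearly independent
coordinates has eventual approximation type `a < 1`, `∃ a b C, a < 1 ∧ ApproxTypeEvAt 2 s a b C` —
the bridge `stub_evLW_two_of_ably` fed with the discharged theorem
`Ably1994_lindemannWeierstrass_measure_holds`. [cite: Ably1994, Théorème p. 30] -/
theorem stub_evLW_two : EvLWTwo :=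
  stub_evLW_two_of_ably Ably1994_lindemannWeierstrass_measure_holds

end Summit.Schanuel.Schanuel.Cruxes.KhovanskiiApproxTypeEv.AnchoredReduction

end
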